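import Mathlib
import Summits.Ventures.HodgeRepro.Tier4.Line4.ArchMatchingCutoff
import Summits.Ventures.HodgeRepro.Tier4.Line4.ArchMatchingSeesaw

/-!
# Tier4/Line4/ArchCutoffLarge — C-L4-7A-NODEF, module 5: LARGE CUTOFF RADII — on the compact `T_∞`-orbit of `γ₀` the
cutoff witness IS the uncut witness, so (7a)'s Fourier print `hF` is the RADIUS-FREE print of p709235 again

Blind re-derivation cell `pub-hodge-repro`, Tier 4 (README §9–§10), seat t4-L1-p5 (prover, gen 5; C-L4-7A-NODEF S15560;
crit-2 g9's Entry 329 record «`hF` at `archWitnessR Rc` is the uncut integral once `Rc ≥ sup_{t ∈ T_∞} locSize (t⁻¹ γ₀)`,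
the sup finite by compactness + `continuous_locSize`» — here as THEOREMS).  Target tree path
`lean/Summits/Ventures/HodgeRepro/Tier4/Line4/ArchCutoffLarge.lean`.  On the seat's `ArchMatchingCutoff` (module 4:
`archWitnessROf`, `d3CoeffData'_seesawR`), `ArchMatchingSeesaw` (p709235: `archWitnessOf`), `ArchWitnessCutoff`,
`ArchProdCutoff`, `LocSizeCutoff` (p709514: `cutoff_eq_one_of_le`, `continuous_locSize`, `locSize_nonneg`),
`ArchProdCoeff` (p705212: `archWitness(')`, `defCoeffProd`); no printed input.

WHAT IS PROVED (kernel, no print): `cutFactor_eq_defCoeff_of_le` (`cutoff = 1` on `{locSize ≤ R}`),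
`placeProd_cutFactor_eq_defCoeffProd_of_le`, **`archWitnessR(')_eq_archWitness(')_of_le`**,
**`archWitnessROf_eq_archWitnessOf_of_le`** (the cutoff witness equals p705212's / p709235's UNCUT witness wherever every
`locSize w′ ≤ R`, `w′ ≠ w₀`); **`exists_locSize_orbit_le`** (`[CompactSpace (torusInf W)]`: `∃ Rb ≥ 0, ∀ w′ t,
locSize w′ (t⁻¹ γ₀) ≤ Rb` — a continuous function on a compact space is bounded); **`exists_forall_archWitnessROf_eq`**,
**`exists_forall_integral_chi_mul_archWitnessROf_eq`** (for every `Rc ≥ Rb` the `T_∞`-Fourier integral of `archWitnessROf Rc`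
at `γ₀` IS that of `archWitnessOf` — no integrability needed, the integrands agree pointwise); and the SUPPORT LEMMA
**`d3CoeffData'_seesawR_of_uncut`** = `d3CoeffData'_seesawR` with `hF` read at the UNCUT witness (radius-free: character
for character p709235's `hF`) and the pseudo-coefficient prints asked for ARBITRARILY LARGE radii
(`hpseudo_cof : ∀ Rb, ∃ Rc ≥ Rb, hpseudo Rc ∧ hpseudo' Rc`); `T_∞` compact is DISCHARGED at the instance
(**`compactSpace_torusInf_seesaw`** = typer-2's `compactSpace_infinitePart_subgroupOf_torusT_ofLinesRow` at the seesaw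
plane, from `_ha 0`, `_ha 2`, `hcm` and the total reality of `maximalRealSubfield E`) — NO new binder relative to
`d3CoeffData'_seesawR`.
(7a) PRINT CENSUS in this packaging: `ArchBallGrowth` (shared with (8)) · `hF` (radius-free, = p709235) · `hpseudo_cof`;
NO `hdef`.  Nothing here says anything about the status of the Hodge conjecture for CM abelian varieties, which is NOT
proved (HC_CM is NOT proved by anyone in this repository).
-/

set_option autoImplicit false

noncomputable section

namespace Summit.Ventures.HodgeRepro.Tier4.Line4

open Summit.Ventures.HodgeRepro.Tier4.Common Summit.Ventures.HodgeRepro.Tier4.Line1 NumberField Matrix MeasureTheory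

open scoped ComplexConjugate

open scoped Classical

section Large

variable {k : Type} [Field k] [NumberField k] (q : QuadData k) (a : Fin 4 → k)
  (g g' : Matrix (Fin 4) (Fin 4) k) (hgg' : g * g' = 1) (hg'g : g' * g = 1)
  (hgΩ : g * (PlaneData.mixedRow q (a 0) (a 2)).Ω = (PlaneData.mixedRow q (a 0) (a 2)).Ω * g)
  (lam : k)
  (hiso : g * (PlaneData.mixedRow q (a 1) (a 3)).B * gᵀ = lam • (PlaneData.mixedRow q (a 0) (a 2)).B)
  (w₀ : InfinitePlace k) (eP' eM' : InfinitePlace k → ℤ) (Rc : ℝ)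

/-- on `{locSize w′ ≤ Rc}` the cutoff is `1`: `cutFactor Rc w′ x = defCoeff w′ (eP′ w′) (eM′ w′) x`. -/
theorem cutFactor_eq_defCoeff_of_le {w' : InfinitePlace k} {x : GA ((PlaneData.mixedRow q (a 0) (a 2)).withTransportedTorus g g' hgg' hg'g hgΩ)}
    (h : locSize q a g g' hgg' hg'g hgΩ lam hiso w' x ≤ Rc) :
    cutFactor q a g g' hgg' hg'g hgΩ lam hiso eP' eM' Rc w' x =
      defCoeff q a g g' hgg' hg'g hgΩ lam hiso w' (eP' w') (eM' w') x := by
  unfold cutFactor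
  rw [cutoff_eq_one_of_le q a g g' hgg' hg'g hgΩ lam hiso w' Rc h, mul_one]

/-- wherever every `locSize w′ ≤ Rc` (`w′ ≠ w₀`), the cutoff product is p705212's `defCoeffProd`. -/
theorem placeProd_cutFactor_eq_defCoeffProd_of_le {x : GA ((PlaneData.mixedRow q (a 0) (a 2)).withTransportedTorus g g' hgg' hg'g hgΩ)}
    (h : ∀ w' : InfinitePlace k, w' ≠ w₀ → locSize q a g g' hgg' hg'g hgΩ lam hiso w' x ≤ Rc) :
    placeProd q a g g' hgg' hg'g hgΩ w₀ (cutFactor q a g g' hgg' hg'g hgΩ lam hiso eP' eM' Rc) x =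
      defCoeffProd q a g g' hgg' hg'g hgΩ lam hiso w₀ eP' eM' x := by
  unfold placeProd defCoeffProd
  refine Finset.prod_congr rfl fun w' hw' => ?_
  exact cutFactor_eq_defCoeff_of_le q a g g' hgg' hg'g hgΩ lam hiso eP' eM' Rc (h w' (Finset.ne_of_mem_erase hw'))

/-- **the cutoff witness is the uncut witness** wherever every `locSize w′ ≤ Rc` (`w′ ≠ w₀`), holomorphic branch. -/
theorem archWitnessR_eq_archWitness_of_le {x : GA ((PlaneData.mixedRow q (a 0) (a 2)).withTransportedTorus g g' hgg' hg'g hgΩ)}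
    (h : ∀ w' : InfinitePlace k, w' ≠ w₀ → locSize q a g g' hgg' hg'g hgΩ lam hiso w' x ≤ Rc) :
    archWitnessR q a g g' hgg' hg'g hgΩ lam hiso w₀ eP' eM' Rc x =
      archWitness q a g g' hgg' hg'g hgΩ lam hiso w₀ eP' eM' x := by
  rw [archWitnessR_apply, placeProd_cutFactor_eq_defCoeffProd_of_le q a g g' hgg' hg'g hgΩ lam hiso w₀ eP' eM' Rc h]
  rfl

/-- antiholomorphic branch. -/
theorem archWitnessR'_eq_archWitness'_of_le {x : GA ((PlaneData.mixedRow q (a 0) (a 2)).withTransportedTorus g g' hgg' hg'g hgΩ)}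
    (h : ∀ w' : InfinitePlace k, w' ≠ w₀ → locSize q a g g' hgg' hg'g hgΩ lam hiso w' x ≤ Rc) :
    archWitnessR' q a g g' hgg' hg'g hgΩ lam hiso w₀ eP' eM' Rc x =
      archWitness' q a g g' hgg' hg'g hgΩ lam hiso w₀ eP' eM' x := by
  rw [archWitnessR'_apply, placeProd_cutFactor_eq_defCoeffProd_of_le q a g g' hgg' hg'g hgΩ lam hiso w₀ eP' eM' Rc h]
  rfl

/-- the branch witnesses agree wherever every `locSize w′ ≤ Rc` (`w′ ≠ w₀`). -/
theorem archWitnessROf_eq_archWitnessOf_of_le {x : GA ((PlaneData.mixedRow q (a 0) (a 2)).withTransportedTorus g g' hgg' hg'g hgΩ)}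
    (h : ∀ w' : InfinitePlace k, w' ≠ w₀ → locSize q a g g' hgg' hg'g hgΩ lam hiso w' x ≤ Rc) :
    archWitnessROf q a g g' hgg' hg'g hgΩ lam hiso w₀ eP' eM' Rc x =
      archWitnessOf q a g g' hgg' hg'g hgΩ lam hiso w₀ eP' eM' x := by
  unfold archWitnessROf archWitnessOf
  split_ifs
  · exact archWitnessR_eq_archWitness_of_le q a g g' hgg' hg'g hgΩ lam hiso w₀ eP' eM' Rc h
  · exact archWitnessR'_eq_archWitness'_of_le q a g g' hgg' hg'g hgΩ lam hiso w₀ eP' eM' Rc h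

/-- **`T_∞` of the seesaw plane is compact** when every infinite place is a real CM place and `a 0, a 2 ≠ 0`: the first
torus is untouched by `withTransportedTorus` and `mixedRow q a₀ a₂ = ofLinesRow q a₀ a₂ (−1)`, so this is typer-2's
`compactSpace_infinitePart_subgroupOf_torusT_ofLinesRow` (TorusInfCompact) by `rfl` on the plane. -/
theorem compactSpace_torusInf_seesaw (ha0 : a 0 ≠ 0) (ha2 : a 2 ≠ 0) (hreal : ∀ w : InfinitePlace k, w.IsReal)
    (hcm : ∀ w, IsCMAt q w) : CompactSpace (torusInf ((PlaneData.mixedRow q (a 0) (a 2)).withTransportedTorus g g' hgg' hg'g hgΩ)) :=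
  compactSpace_infinitePart_subgroupOf_torusT_ofLinesRow q (a 0) (a 2) (-1) ha0 ha2 (neg_ne_zero.2 one_ne_zero) hreal hcm

/-- **the `T_∞`-orbit of `γ₀` has bounded local size** when `T_∞` is compact: `∃ Rb ≥ 0, ∀ w′, ∀ t ∈ T_∞,
locSize w′ (t⁻¹ γ₀) ≤ Rb` (`t ↦ ∑_{w′} locSize w′ (t⁻¹ γ₀)` is continuous on a compact space, hence bounded). -/
theorem exists_locSize_orbit_le [CompactSpace (torusInf ((PlaneData.mixedRow q (a 0) (a 2)).withTransportedTorus g g' hgg' hg'g hgΩ))] (γ₀ : GA ((PlaneData.mixedRow q (a 0) (a 2)).withTransportedTorus g g' hgg' hg'g hgΩ)) :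
    ∃ Rb : ℝ, 0 ≤ Rb ∧ ∀ (w' : InfinitePlace k) (t : torusInf ((PlaneData.mixedRow q (a 0) (a 2)).withTransportedTorus g g' hgg' hg'g hgΩ)),
      locSize q a g g' hgg' hg'g hgΩ lam hiso w' (((t : torusT ((PlaneData.mixedRow q (a 0) (a 2)).withTransportedTorus g g' hgg' hg'g hgΩ)) : GA ((PlaneData.mixedRow q (a 0) (a 2)).withTransportedTorus g g' hgg' hg'g hgΩ))⁻¹ * γ₀) ≤ Rb := by
  set f : torusInf ((PlaneData.mixedRow q (a 0) (a 2)).withTransportedTorus g g' hgg' hg'g hgΩ) → ℝ := fun t => ∑ w' : InfinitePlace k,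
    locSize q a g g' hgg' hg'g hgΩ lam hiso w' (((t : torusT ((PlaneData.mixedRow q (a 0) (a 2)).withTransportedTorus g g' hgg' hg'g hgΩ)) : GA ((PlaneData.mixedRow q (a 0) (a 2)).withTransportedTorus g g' hgg' hg'g hgΩ))⁻¹ * γ₀) with hf
  have hcont : Continuous f := continuous_finsetSum _ fun w' _ =>
    (continuous_locSize q a g g' hgg' hg'g hgΩ lam hiso w').comp
      ((continuous_subtype_val.comp continuous_subtype_val).inv.mul continuous_const)
  obtain ⟨C, hC⟩ := (isCompact_univ.image hcont).bddAbove
  refine ⟨max 0 C, le_max_left _ _, fun w' t => ?_⟩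
  have h1 : f t ≤ C := hC ⟨t, Set.mem_univ _, rfl⟩
  have h2 : locSize q a g g' hgg' hg'g hgΩ lam hiso w' (((t : torusT ((PlaneData.mixedRow q (a 0) (a 2)).withTransportedTorus g g' hgg' hg'g hgΩ)) : GA ((PlaneData.mixedRow q (a 0) (a 2)).withTransportedTorus g g' hgg' hg'g hgΩ))⁻¹ * γ₀) ≤ f t :=
    Finset.single_le_sum (fun w'' _ => locSize_nonneg q a g g' hgg' hg'g hgΩ lam hiso w'' _) (Finset.mem_univ w')
  exact h2.trans (h1.trans (le_max_right _ _))

/-- **for every radius beyond the orbit bound the cutoff witness IS the uncut witness on the `T_∞`-orbit of `γ₀`**. -/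
theorem exists_forall_archWitnessROf_eq [CompactSpace (torusInf ((PlaneData.mixedRow q (a 0) (a 2)).withTransportedTorus g g' hgg' hg'g hgΩ))] (γ₀ : GA ((PlaneData.mixedRow q (a 0) (a 2)).withTransportedTorus g g' hgg' hg'g hgΩ)) :
    ∃ Rb : ℝ, 0 ≤ Rb ∧ ∀ Rc' : ℝ, Rb ≤ Rc' → ∀ t : torusInf ((PlaneData.mixedRow q (a 0) (a 2)).withTransportedTorus g g' hgg' hg'g hgΩ),
      archWitnessROf q a g g' hgg' hg'g hgΩ lam hiso w₀ eP' eM' Rc' (((t : torusT ((PlaneData.mixedRow q (a 0) (a 2)).withTransportedTorus g g' hgg' hg'g hgΩ)) : GA ((PlaneData.mixedRow q (a 0) (a 2)).withTransportedTorus g g' hgg' hg'g hgΩ))⁻¹ * γ₀) =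
        archWitnessOf q a g g' hgg' hg'g hgΩ lam hiso w₀ eP' eM' (((t : torusT ((PlaneData.mixedRow q (a 0) (a 2)).withTransportedTorus g g' hgg' hg'g hgΩ)) : GA ((PlaneData.mixedRow q (a 0) (a 2)).withTransportedTorus g g' hgg' hg'g hgΩ))⁻¹ * γ₀) := by
  obtain ⟨Rb, hRb, hle⟩ := exists_locSize_orbit_le q a g g' hgg' hg'g hgΩ lam hiso γ₀
  exact ⟨Rb, hRb, fun Rc' hRc' t => archWitnessROf_eq_archWitnessOf_of_le q a g g' hgg' hg'g hgΩ lam hiso w₀ eP' eM' Rc'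
    fun w' _ => (hle w' t).trans hRc'⟩

variable [MeasurableSpace (GA ((PlaneData.mixedRow q (a 0) (a 2)).withTransportedTorus g g' hgg' hg'g hgΩ))]

/-- **the `T_∞`-Fourier integral of the cutoff witness at `γ₀` is radius-free beyond the orbit bound**: for every
`Rc ≥ Rb`, `∫_{T_∞} χ(t) archWitnessROf Rc (t⁻¹ γ₀) dν = ∫_{T_∞} χ(t) archWitnessOf (t⁻¹ γ₀) dν` (the integrands agree
pointwise; no integrability is used). -/
theorem exists_forall_integral_chi_mul_archWitnessROf_eq [CompactSpace (torusInf ((PlaneData.mixedRow q (a 0) (a 2)).withTransportedTorus g g' hgg' hg'g hgΩ))]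
    (R : RTFData ((PlaneData.mixedRow q (a 0) (a 2)).withTransportedTorus g g' hgg' hg'g hgΩ)) (γ₀ : GA ((PlaneData.mixedRow q (a 0) (a 2)).withTransportedTorus g g' hgg' hg'g hgΩ)) (νinf : Measure (torusInf ((PlaneData.mixedRow q (a 0) (a 2)).withTransportedTorus g g' hgg' hg'g hgΩ))) :
    ∃ Rb : ℝ, 0 ≤ Rb ∧ ∀ Rc' : ℝ, Rb ≤ Rc' →
      (∫ t : torusInf ((PlaneData.mixedRow q (a 0) (a 2)).withTransportedTorus g g' hgg' hg'g hgΩ), R.chi t * archWitnessROf q a g g' hgg' hg'g hgΩ lam hiso w₀ eP' eM' Rc'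
          (((t : torusT ((PlaneData.mixedRow q (a 0) (a 2)).withTransportedTorus g g' hgg' hg'g hgΩ)) : GA ((PlaneData.mixedRow q (a 0) (a 2)).withTransportedTorus g g' hgg' hg'g hgΩ))⁻¹ * γ₀) ∂νinf) =
        ∫ t : torusInf ((PlaneData.mixedRow q (a 0) (a 2)).withTransportedTorus g g' hgg' hg'g hgΩ), R.chi t * archWitnessOf q a g g' hgg' hg'g hgΩ lam hiso w₀ eP' eM'
          (((t : torusT ((PlaneData.mixedRow q (a 0) (a 2)).withTransportedTorus g g' hgg' hg'g hgΩ)) : GA ((PlaneData.mixedRow q (a 0) (a 2)).withTransportedTorus g g' hgg' hg'g hgΩ))⁻¹ * γ₀) ∂νinf := by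
  obtain ⟨Rb, hRb, heq⟩ := exists_forall_archWitnessROf_eq q a g g' hgg' hg'g hgΩ lam hiso w₀ eP' eM' γ₀
  refine ⟨Rb, hRb, fun Rc' hRc' => ?_⟩
  congr 1
  funext t
  rw [heq Rc' hRc' t]

end Large

section Seesaw

variable {E : Type} [Field E] [NumberField E]

/-- **THE (7a) SUPPORT LEMMA WITH A RADIUS-FREE FOURIER PRINT**: `d3CoeffData'_seesawR` with `hF` read at the UNCUT witness
`archWitnessOf` (character for character p709235's `hF`) and the pseudo-coefficient prints asked for arbitrarily large cutoff
radii (`hpseudo_cof`); `T_∞` compact is discharged inline (`compactSpace_torusInf_seesaw`). No `hdef`, no new binder. -/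
theorem d3CoeffData'_seesawR_of_uncut (q : QuadData ↥(maximalRealSubfield E)) (a : Fin 4 → ↥(maximalRealSubfield E))
    (_ha : ∀ i, a i ≠ 0) (φ : ↥(maximalRealSubfield E) →+* ℂ) (_hpos : ∀ i, 0 < (φ (a i)).re)
    (g g' : Matrix (Fin 4) (Fin 4) ↥(maximalRealSubfield E)) (hgg' : g * g' = 1) (hg'g : g' * g = 1)
    (hgΩ : g * (PlaneData.mixedRow q (a 0) (a 2)).Ω = (PlaneData.mixedRow q (a 0) (a 2)).Ω * g)
    (lam : ↥(maximalRealSubfield E)) (_hlam : lam ≠ 0)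
    (_hiso : g * (PlaneData.mixedRow q (a 1) (a 3)).B * gᵀ = lam • (PlaneData.mixedRow q (a 0) (a 2)).B)
    [MeasurableSpace (GA ((PlaneData.mixedRow q (a 0) (a 2)).withTransportedTorus g g' hgg' hg'g hgΩ))]
    [BorelSpace (GA ((PlaneData.mixedRow q (a 0) (a 2)).withTransportedTorus g g' hgg' hg'g hgΩ))]
    (R : RTFData ((PlaneData.mixedRow q (a 0) (a 2)).withTransportedTorus g g' hgg' hg'g hgΩ))
    [R.μT.IsHaarMeasure] [R.μT'.IsHaarMeasure]
    (eP eM eP' eM' : InfinitePlace ↥(maximalRealSubfield E) → ℤ)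
    (_he : eP (InfinitePlace.mk φ) - eM (InfinitePlace.mk φ) = 3 ∨ eP (InfinitePlace.mk φ) - eM (InfinitePlace.mk φ) = -3)
    (_he' : (0 < (φ lam).re → eP' (InfinitePlace.mk φ) - eM' (InfinitePlace.mk φ) =
        eP (InfinitePlace.mk φ) - eM (InfinitePlace.mk φ)) ∧
      ((φ lam).re < 0 → eP' (InfinitePlace.mk φ) - eM' (InfinitePlace.mk φ) =
        -(eP (InfinitePlace.mk φ) - eM (InfinitePlace.mk φ))))
    (_hchi' : ∀ w : InfinitePlace ↥(maximalRealSubfield E),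
      ChiMatchesAt' ((PlaneData.mixedRow q (a 0) (a 2)).withTransportedTorus g g' hgg' hg'g hgΩ) q w g g' (eP' w) (eM' w)
        R.chi')
    (μ : Measure (GA ((PlaneData.mixedRow q (a 0) (a 2)).withTransportedTorus g g' hgg' hg'g hgΩ))) [μ.IsHaarMeasure]
    (DG : Set (GA ((PlaneData.mixedRow q (a 0) (a 2)).withTransportedTorus g g' hgg' hg'g hgΩ)))
    (fdG : IsFundamentalDomain (rationalPoints ((PlaneData.mixedRow q (a 0) (a 2)).withTransportedTorus g g' hgg' hg'g hgΩ))
      DG μ)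
    (compG : IsCompact (closure DG)) (compT : IsCompact (closure R.DT)) (compT' : IsCompact (closure R.DT'))
    (hcm : ∀ w : InfinitePlace ↥(maximalRealSubfield E), IsCMAt q w)
    (γ₀ : GA ((PlaneData.mixedRow q (a 0) (a 2)).withTransportedTorus g g' hgg' hg'g hgΩ))
    (νinf : Measure (torusInf ((PlaneData.mixedRow q (a 0) (a 2)).withTransportedTorus g g' hgg' hg'g hgΩ)))
    (νinf' : Measure (torusInf' ((PlaneData.mixedRow q (a 0) (a 2)).withTransportedTorus g g' hgg' hg'g hgΩ)))
    [νinf'.IsHaarMeasure]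
    (μinf : Measure (infinitePart ((PlaneData.mixedRow q (a 0) (a 2)).withTransportedTorus g g' hgg' hg'g hgΩ)))
    [μinf.IsHaarMeasure]
    (hgrowth : ArchBallGrowth ((PlaneData.mixedRow q (a 0) (a 2)).withTransportedTorus g g' hgg' hg'g hgΩ) μinf)
    (hF : (∫ t : torusInf ((PlaneData.mixedRow q (a 0) (a 2)).withTransportedTorus g g' hgg' hg'g hgΩ),
        R.chi t * archWitnessOf q a g g' hgg' hg'g hgΩ lam _hiso (InfinitePlace.mk φ) eP' eM'
          (((t : torusT ((PlaneData.mixedRow q (a 0) (a 2)).withTransportedTorus g g' hgg' hg'g hgΩ)) :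
            GA ((PlaneData.mixedRow q (a 0) (a 2)).withTransportedTorus g g' hgg' hg'g hgΩ))⁻¹ * γ₀) ∂νinf) ≠ 0)
    (hpseudo_cof : ∀ Rb : ℝ, ∃ Rc : ℝ, Rb ≤ Rc ∧
      (∀ ffin : GA ((PlaneData.mixedRow q (a 0) (a 2)).withTransportedTorus g g' hgg' hg'g hgΩ) → ℂ,
        L1Class.IsFinFactor ((PlaneData.mixedRow q (a 0) (a 2)).withTransportedTorus g g' hgg' hg'g hgΩ) ffin →
        IsPseudoCoeffAt ((PlaneData.mixedRow q (a 0) (a 2)).withTransportedTorus g g' hgg' hg'g hgΩ)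
          (Setting.ofAdelicData ((PlaneData.mixedRow q (a 0) (a 2)).withTransportedTorus g g' hgg' hg'g hgΩ) R μ DG fdG
          compG compT compT') q (InfinitePlace.mk φ) eP eM
          (RTF.cj (L1Class.prodFn ((PlaneData.mixedRow q (a 0) (a 2)).withTransportedTorus g g' hgg' hg'g hgΩ)
            (archWitnessROf q a g g' hgg' hg'g hgΩ lam _hiso (InfinitePlace.mk φ) eP' eM' Rc) ffin))) ∧
      (∀ ffin : GA ((PlaneData.mixedRow q (a 0) (a 2)).withTransportedTorus g g' hgg' hg'g hgΩ) → ℂ,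
        L1Class.IsFinFactor ((PlaneData.mixedRow q (a 0) (a 2)).withTransportedTorus g g' hgg' hg'g hgΩ) ffin →
        IsPseudoCoeffAt' ((PlaneData.mixedRow q (a 0) (a 2)).withTransportedTorus g g' hgg' hg'g hgΩ)
          (Setting.ofAdelicData ((PlaneData.mixedRow q (a 0) (a 2)).withTransportedTorus g g' hgg' hg'g hgΩ) R μ DG fdG
          compG compT compT') q g g' (InfinitePlace.mk φ) eP' eM'
          (RTF.cj (L1Class.prodFn ((PlaneData.mixedRow q (a 0) (a 2)).withTransportedTorus g g' hgg' hg'g hgΩ)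
            (archWitnessROf q a g g' hgg' hg'g hgΩ lam _hiso (InfinitePlace.mk φ) eP' eM' Rc) ffin)))) :
    L1Class.D3CoeffData' ((PlaneData.mixedRow q (a 0) (a 2)).withTransportedTorus g g' hgg' hg'g hgΩ)
      (Setting.ofAdelicData ((PlaneData.mixedRow q (a 0) (a 2)).withTransportedTorus g g' hgg' hg'g hgΩ) R μ DG fdG
          compG compT compT') R q g g' (InfinitePlace.mk φ) eP eM eP' eM' γ₀ νinf νinf' := by
  have hreal : ∀ w : InfinitePlace ↥(maximalRealSubfield E), w.IsReal := fun w => IsTotallyReal.isReal w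
  haveI : CompactSpace (torusInf ((PlaneData.mixedRow q (a 0) (a 2)).withTransportedTorus g g' hgg' hg'g hgΩ)) :=
    compactSpace_torusInf_seesaw q a g g' hgg' hg'g hgΩ (_ha 0) (_ha 2) hreal hcm
  obtain ⟨Rb, hRb, heq⟩ := exists_forall_integral_chi_mul_archWitnessROf_eq q a g g' hgg' hg'g hgΩ lam _hiso
    (InfinitePlace.mk φ) eP' eM' R γ₀ νinf
  obtain ⟨Rc, hRc, hpseudo, hpseudo'⟩ := hpseudo_cof Rb
  refine d3CoeffData'_seesawR q a _ha φ _hpos g g' hgg' hg'g hgΩ lam _hlam _hiso R eP eM eP' eM' _he _he' _hchi' μ DG fdG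
    compG compT compT' hcm γ₀ νinf νinf' μinf hgrowth Rc (hRb.trans hRc) ?_ hpseudo hpseudo'
  rw [heq Rc hRc]
  exact hF

end Seesaw

end Summit.Ventures.HodgeRepro.Tier4.Line4

end
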